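/-
Copyright (c) 2026. Released under Apache 2.0 license.
-/
import Literature.NumberTheory.EllipticCurves.XZeroThirtyTwoEtaQuotientUnits
import HarnessLib

/-!
# The level-`32` `η`-quotient `s = η(16τ)³/(η(8τ)η(32τ)²)`, square root of the coordinate
# `x_η = η(16τ)⁶/(η(8τ)²η(32τ)⁴)` of `X₀(32) ≅ A : y² = x³ + 4x` — exponent vector and Newman data

Topic `Literature/NumberTheory/EllipticCurves`; namespace
`Literature.NumberTheory.EllipticCurves.ModularForms` (sequel of `XZeroThirtyTwoEtaQuotientUnits`). Cell
`bsd-print-cf2`, typer seat `-ty2` (g51), the INSTANCE half of deliverable **(A1)** of the pen's SUMMON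
2026-08-31T03:11:49Z for crux `stmt-BirchSwinnertonDyer-20509` (THEOREM A; LEAD memo
`Lines/offtyz_v7_ExactDescent.md` §2a: «`x = s²`, `s := η(16τ)³/(η(8τ)η(32τ)²) = q⁻¹∏(1−q^{16m})³(1−q^{8m})⁻¹
(1−q^{32m})⁻²`, an η-quotient of weight 0 and level 32 with `Σ δ r_δ = −24`, `Σ (32/δ) r_δ = 0`,
`∏ δ^{r_δ} = 1/2` NOT a square»). This file holds the ONE definition with body — the exponent vector `rS`, as
its siblings `rX`, `rXsq`, `rY` of the g47 file — and its decidable data (`decide`); every theorem ABOUT `s`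
(the character `(2/·)` on `Γ₀(32)`, `Γ(32)`-invariance, `x_η = s²`, the integral q-expansion, boundedness of
`q·(s∣γ)` at every cusp) is PROVED in the companion `XZeroThirtyTwoEtaQuotientSqrtXProofs.lean`. No named
fact, no instance, no notation.

## References

* D. Savitt, *An elementary proof of Newman's eta-quotient theorem*, Res. Number Theory 11 (2025),
  arXiv:2507.16225 — Thm. 1, Rem. 2. [Savitt2025]
* G. Ligozat, *Courbes modulaires de genre 1*, Mém. SMF 43 (1975), Prop. 3.2.1, Prop. 3.2.8. [Ligozat1975]
-/

noncomputable section

open scoped NumberTheorySymbols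

namespace Literature.NumberTheory.EllipticCurves.ModularForms

/-! ## The exponent vector of `s = η(16τ)³ η(8τ)⁻¹ η(32τ)⁻²` -/

/-- Exponents of `s = η(16τ)³ η(8τ)⁻¹ η(32τ)⁻²`, the square root of `x_η` (`rX = 2·rS`, companion file).
[cite: Ligozat1975, Prop. 3.2.1 (the family r = (r_δ)_{δ∣N})] -/
def rS : ℕ → ℤ := fun δ => if δ = 16 then 3 else if δ = 8 then -1 else if δ = 32 then -2 else 0

/-- `Σ r_δ = 0` (weight `0`). [cite: Savitt2025, Thm. 1] -/
theorem rS_sum : ∑ δ ∈ Nat.divisors 32, rS δ = 2 * 0 := by decide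

/-- Newman's first congruence: `Σ δ r_δ = −24 ≡ 0 (mod 24)`. [cite: Savitt2025, Thm. 1] -/
theorem rS_sum_mul : ∑ δ ∈ Nat.divisors 32, (δ : ℤ) * rS δ = -24 := by decide

/-- `24 ∣ Σ δ r_δ`. [cite: Savitt2025, Thm. 1] -/
theorem rS_sum_mul_dvd : (24 : ℤ) ∣ ∑ δ ∈ Nat.divisors 32, (δ : ℤ) * rS δ := by decide

/-- Newman's second congruence: `Σ (32/δ) r_δ = 0`. [cite: Savitt2025, Thm. 1] -/
theorem rS_sum_div : ∑ δ ∈ Nat.divisors 32, ((32 / δ : ℕ) : ℤ) * rS δ = 0 := by decide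

/-- `24 ∣ Σ (32/δ) r_δ`. [cite: Savitt2025, Thm. 1] -/
theorem rS_sum_div_dvd : (24 : ℤ) ∣ ∑ δ ∈ Nat.divisors 32, ((32 / δ : ℕ) : ℤ) * rS δ := by decide

/-- `∏ δ^{|r_δ|} = 8·16³·32² = 2²⁵` — NOT a square: the character is `(2/·)`. [cite: Savitt2025, Thm. 1] -/
theorem rS_prod_pow_natAbs : ∏ δ ∈ Nat.divisors 32, δ ^ (rS δ).natAbs = 2 ^ 25 := by decide

/-- **Ligozat's orders of `s` at the cusps of `X₀(32)`** (times `24·32`), at the cusp levels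
`d = 1, 2, 4, 8, 16, 32`: `(0, 0, 0, 0, 768, −768)` — a simple zero at the cusp of level `16`, a simple pole
at `∞`, order `0` elsewhere (half the orders of `x_η`, `cuspOrder24_level32`). [cite: Ligozat1975, Prop. 3.2.8] [cite: Savitt2025, Rem. 2] -/
theorem cuspOrder24_rS :
    cuspOrder24 32 rS 1 = 0 ∧ cuspOrder24 32 rS 2 = 0 ∧ cuspOrder24 32 rS 4 = 0 ∧
      cuspOrder24 32 rS 8 = 0 ∧ cuspOrder24 32 rS 16 = 768 ∧ cuspOrder24 32 rS 32 = -768 := by decide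

end Literature.NumberTheory.EllipticCurves.ModularForms

end
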